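import Summits.QuantumFields.YangMills.Theorems.BalabanUVNodesN16UniformScalarJensen
import HarnessLib

/-!
# YM-DAG node N16 (NE3), the re-keyed N07 in-edge — AT RANK ONE, EVERY MINIMISER AT A UNIFORM-CURVATURE DATUM IS UNIFORM: on the scalar uniform-curvature data `𝒟_unif` the
# constrained minimisers of [Balaban1985Variational]'s problem over the (8)-class are EXACTLY the central gauge transforms of the Landau field of curvature `ω∕L^{2k}`
# (Jensen for `1 − cos` + the flux transport of file 5); the minimal action is `L^{(4−(d+2))k}·(N L^k)^{d+2}·(1 − cos(ω∕L^{2k}))`, and the minimiser is unique up to gauge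
# (file 6 of the g6 piece)

Cell `pub-ymgap`, width seat `pub-ymgap-dag-n16-w2` (director-ym №197 ∕ HUMAN RULING D-0149), generation 6.  `--kind proof --supports stmt-QuantumFields-27366 --as helper`
(K3⁸, KEY MAP v2).  `bears_on: R4∕N16`, edge N07 → N16.  COUNT-NEUTRAL.

HONEST FRAMING.  The ABELIAN, RANK-ONE model (`n` a one-element index type, i.e. `U(1)`-valued lattice fields): kernel bookkeeping over files 3–5 of this generation and
Mathlib's Jensen inequality for the strictly concave `cos` on `[−π∕2, π∕2]`.  It is NOT [Balaban1985Variational] Theorem 1 (non-abelian, general data), and says nothing about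
`U(N)`, `N ≥ 2`.  Nothing of Bałaban is asserted or refuted; DischargeTest `stub_reg910Slot` NOT closed; no K3⁸ v6 stub named or closed; N16 ∕ N07 NOT discharged; counts UNMOVED
(typed 28∕28 · discharged 5∕27 · A 5∕28).  R4 closes the conditional finite-𝕋⁴ rung `BalabanLadder.UV` only; NOT ℝ⁴ ∕ OS ∕ mass gap; the YM mass gap (Clay) is NOT proved by any of this.

WHAT IS PROVED ([folklore], 0 `sorry`, 0 `def`; `[Unique n]` = rank one; file 6a `…N16UniformScalarJensen` supplies the rank-one presentation, the `(e₀,e₁)`-plane domination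
and Jensen).  `sum_periodBox_wt_real` (the plane part is `Σ_x (1 − cos θ_A(x))`), ★★ `levelAction_ge_of_admissible`: at an `N`-periodic scalar datum of uniform `(e₀,e₁)`-curvature `ω` (`|ω| ≤ 1∕2`, leaf-05's regime), EVERY
admissible competitor of run `k` has `levelAction ≥ (stepWt⁻¹)^k · (NL^k)^{d+2} · (1 − cos(ω∕L^{2k}))` (file 5: its mean principal angle is exactly `ω∕L^{2k}`); ★★
`levelAction_of_landau_plaquettes`: a competitor with the Landau field's plaquette variables attains it; hence ★★★
`minAct_uniformScalar` (the minimal action), `plaquettes_of_isMinimiser` (EVERY minimiser has the Landau field's plaquette variables: `e^{±iω∕L^{2k}}·1` on the `(e₀,e₁)`-plane, `1`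
elsewhere), `exists_central_gauge_of_isMinimiser` (every minimiser is a CENTRAL unitary gauge transform of the Landau field `U_{ω∕L^{2k},0,0}` — file 2's lemma), and
`isMinimiser_unique_up_to_gauge` (two minimisers differ by a central unitary gauge).  With file 3's existence this is the WHOLE variational picture of the slot key on `𝒟_unif` in the
rank-one model: existence at a `k`-uniform radius, uniqueness up to gauge, and the explicit (uniform, hence (9)–(10)-regular in the comb gauge) form of the minimiser.

DEPENDENCES (by name): file 5 (`sliceFlux_of_admissible`); file 4 (`wt_hol_plaqWord_real`, `abs_toIocMod_le_two_mul`, `toIocMod_eq_of_cexp_smul_one_eq`, `val_hol_plaqWord_real`,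
`cexp_toIocMod_mul_I`, `cos_toIocMod`); file 3 (`exists_periodic_uniform_preimage`); file 2 (`exists_central_gauge_of_hol_plaqWord_eq`, `smul_one_inj`); file 1
(`hol_plaqWord_landau`, `isUnitaryCfg_landau`); `T4AveragingDeficitWallBoundary` (`scalarCfg`, `π₀`, `snd_ne_one_of_ne`, `wt_expUnit_smul_one`, `periodBox`, `card_periodBox`,
`mem_periodBox`); `T4AveragingDeficitWall` (`wt`, `wt_one`, `fhol`, `fineAction`); `MinimalActionLevels` (`levelAction`, `perWin`, `stepWt`, `stepWt_pos`, `wt_nonneg_of_unitary`);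
`MinimalActionSandwich` (`IsMinimiser`, `admissible`, `minAct`, `IsMinimiser.minAct_eq`); `B7Prop2Explicit` (`hol_mem_of`, `mem_unitaryUnits`, `hol_plaqWord_self`); Mathlib
(`strictConcaveOn_cos_Icc`, `ConcaveOn.le_map_sum`, `StrictConcaveOn.map_sum_eq_iff`, `Complex.norm_mul_exp_arg_mul_I`, `Real.cos_eq_one_iff_of_lt_of_lt`).
-/

open scoped BigOperators Matrix Matrix.Norms.L2Operator
open NormedSpace Finset

namespace Summit.QuantumFields.YangMills.BalabanUVNodes.N16UniformScalarMinimisers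

open Literature.MathematicalPhysics.QuantumFieldTheory.Balaban1983to89
open B7Prop1Explicit B7Prop2Explicit MatrixLog UnitaryModel
open T4AveragingDeficitWall hiding Site Plane Plaq Bond
open T4AveragingDeficitWallBoundary (scalarCfg hol_scalarCfg val_hol_scalarCfg IsPeriodicCfg periodBox card_periodBox mem_periodBox π₀ snd_ne_one_of_ne snd_ne_zero
  wt_expUnit_smul_one fin_zero_ne_one fin_one_ne_zero exp_add_smul_one)
open FederbushMean (cexp_smul_one norm_smul_one_sub_one)
open T4AveragingDeficitNonAbelian (hol_add_period)
open Summit.QuantumFields.BalabanUV.T4Continuum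
open MinimalActionClassSixNeg (isUnitaryCfg_scalarCfg_imag)
open MinimalActionLevels (levelAction perWin stepWt stepWt_pos wt_nonneg_of_unitary)
open MinimalActionSandwich (IsMinimiser admissible minAct)
open MinimalActionRate (sfClass)
open PeriodicChoice (apply_wrap_eq wrap_mem_periodBox)
open Summit.QuantumFields.YangMills.BalabanUVNodes.N16UniformScalarAverage (hol_plaqWord_landau isUnitaryCfg_landau)
open Summit.QuantumFields.YangMills.BalabanUVNodes.N16UniformScalarSeam (exists_central_gauge_of_hol_plaqWord_eq smul_one_inj)
open Summit.QuantumFields.YangMills.BalabanUVNodes.N16Exists8UniformScalar (exists_periodic_uniform_preimage)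
open Summit.QuantumFields.YangMills.BalabanUVNodes.N16ScalarAverageChern (wt_hol_plaqWord_real abs_toIocMod_le_two_mul toIocMod_eq_of_cexp_smul_one_eq val_hol_plaqWord_real
  cexp_toIocMod_mul_I cos_toIocMod abs_toIocMod_le_pi)
open Summit.QuantumFields.YangMills.BalabanUVNodes.N16ScalarFluxTransport (sliceFlux_of_admissible toIocMod_periodic)
open Summit.QuantumFields.YangMills.BalabanUVNodes.N16UniformScalarJensen (exists_real_presentation sum_perWin_ge_plane01 wt_eq_zero_of_sum_perWin_eq
  jensen_one_sub_cos jensen_one_sub_cos_eq_iff)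

noncomputable section

variable {d : ℕ} {n : Type} [Fintype n] [DecidableEq n]

/-! ## §3 Minimisers at a uniform-curvature scalar datum (rank one) -/

section Minimisers

variable [Unique n] {L N k : ℕ} {ec ω : ℝ} {G : B7Prop1Explicit.Site (d + 2) → Fin (d + 2) → ℝ}

/-- The `(e₀,e₁)`-plane part of the fine action of `U_A` over the period box reads the principal angles: `Σ_x (1 − cos θ_A(x))`. [folklore] -/
theorem sum_periodBox_wt_real (A : B7Prop1Explicit.Site (d + 2) → Fin (d + 2) → ℝ) (M : ℕ) :
    ∑ x ∈ periodBox M, wt (hol (scalarCfg (n := n) (fun y ν => ((A y ν : ℝ) : ℂ) * Complex.I)) x (plaqWord 0 1))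
      = ∑ x ∈ periodBox M, (1 - Real.cos (toIocMod Real.two_pi_pos (-Real.pi) (asum A x (plaqWord 0 1)))) :=
  Finset.sum_congr rfl fun x _ => wt_hol_plaqWord_real (n := n) A x 0 1

/-- **★★ THE LOWER BOUND**: at an `N`-periodic scalar datum `V = e^{iG}·1` of uniform `(e₀,e₁)`-curvature `ω` (`|ω| ≤ 1∕2`; `L ≥ 2`, `N ≥ 1`, leaf-05's regime for the class
radius `ec`), EVERY admissible competitor of run `k` over `sfClass (d+2) L N ec` has `levelAction ≥ (stepWt⁻¹)^k · (N L^k)^{d+2} · (1 − cos(ω ∕ L^{2k}))` — rank one + file 5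
(its mean principal `(e₀,e₁)`-angle is `ω∕L^{2k}`) + Jensen. [cite: Balaban1985Variational, (5)–(8) pp.278–279] -/
theorem levelAction_ge_of_admissible (hL : 2 ≤ L) (hN : 1 ≤ N) (he0 : 0 ≤ ec) (he1 : 16 * C0 (d + 2) * ec ≤ 3)
    (he2 : 1024 * ((d + 2 : ℕ) + 1 : ℝ) * ((d + 2 : ℕ) + 4) * (L : ℝ) ^ 2 * ec ≤ 1) (hω : |ω| ≤ 1 / 2)
    (hV01 : ∀ x : B7Prop1Explicit.Site (d + 2), hol (scalarCfg (n := n) (fun y ν => ((G y ν : ℝ) : ℂ) * Complex.I)) x (plaqWord 0 1)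
      = expUnit ((((ω : ℝ) : ℂ) * Complex.I) • (1 : Matrix n n ℂ)))
    {U : B7Prop1Explicit.Site (d + 2) → Fin (d + 2) → (Matrix n n ℂ)ˣ}
    (hU : U ∈ admissible (sfClass (d + 2) L N ec) L k (scalarCfg (n := n) (fun y ν => ((G y ν : ℝ) : ℂ) * Complex.I))) :
    ((stepWt (d + 2) L)⁻¹) ^ k * (((N * L ^ k : ℕ) : ℝ) ^ (d + 2) * (1 - Real.cos (ω / (L : ℝ) ^ (2 * k)))) ≤ levelAction (d + 2) L N k U := by
  have hL1 : 1 ≤ L := by omega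
  obtain ⟨A, rfl⟩ := exists_real_presentation (n := n) hU.1.1
  obtain ⟨_, hbox⟩ := sliceFlux_of_admissible (n := n) hL hN he0 he1 he2 hω hV01 hU
  set M : ℕ := N * L ^ k with hMdef
  have hM : 1 ≤ M := Nat.one_le_iff_ne_zero.mpr (Nat.mul_ne_zero (by omega) (pow_ne_zero _ (by omega)))
  have hMr : (0 : ℝ) < (M : ℝ) := by exact_mod_cast (show 0 < M by omega)
  -- the mean principal angle is `ω / L^{2k}`
  have hne : (periodBox (d := d + 2) M).Nonempty := by
    rw [← Finset.card_pos, card_periodBox]; positivity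
  have hmean : (∑ x ∈ periodBox M, toIocMod Real.two_pi_pos (-Real.pi) (asum A x (plaqWord 0 1))) / (periodBox (d := d + 2) M).card
      = ω / (L : ℝ) ^ (2 * k) := by
    have hMne : ((M : ℕ) : ℝ) ≠ 0 := by positivity
    have hN0 : (N : ℝ) ≠ 0 := by exact_mod_cast (show N ≠ 0 by omega)
    have hL0 : (L : ℝ) ≠ 0 := by exact_mod_cast (show L ≠ 0 by omega)
    have hsum : ∑ x ∈ periodBox M, toIocMod Real.two_pi_pos (-Real.pi) (asum A x (plaqWord 0 1)) = ((M : ℕ) : ℝ) ^ d * ((N : ℝ) ^ 2 * ω) := by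
      apply mul_left_cancel₀ (pow_ne_zero 2 hMne)
      rw [hbox]; ring
    rw [card_periodBox, hsum, Nat.cast_pow, hMdef, Nat.cast_mul, Nat.cast_pow, pow_mul]
    field_simp
    ring
  -- angles are `≤ 2·(ec/(L^k)²) ≤ π/2`
  have hθ : ∀ x ∈ periodBox M, |toIocMod Real.two_pi_pos (-Real.pi) (asum A x (plaqWord 0 1))| ≤ Real.pi / 2 := by
    intro x _
    refine (abs_toIocMod_le_two_mul (n := n) hU.1.2.2 x fin_zero_ne_one).trans ?_
    have hL1r : (1 : ℝ) ≤ ((L : ℝ) ^ k) ^ 2 := one_le_pow₀ (one_le_pow₀ (by exact_mod_cast hL1))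
    have h1 : ec / ((L : ℝ) ^ k) ^ 2 ≤ ec := div_le_self he0 hL1r
    have h2 : ec ≤ 1 / 1024 := by
      have hd0 : (0 : ℝ) ≤ d := by positivity
      have hL2r : (2 : ℝ) ≤ L := by exact_mod_cast hL
      have h4 : (4 : ℝ) ≤ ((d + 2 : ℕ) + 1 : ℝ) * ((d + 2 : ℕ) + 4) := by push_cast; nlinarith
      have hL2 : (1 : ℝ) ≤ (L : ℝ) ^ 2 := by nlinarith
      have h44 : (4 : ℝ) ≤ ((d + 2 : ℕ) + 1 : ℝ) * ((d + 2 : ℕ) + 4) * (L : ℝ) ^ 2 := by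
        have := mul_le_mul h4 hL2 zero_le_one (by positivity); linarith
      nlinarith
    have hπ : (3 : ℝ) < Real.pi := Real.pi_gt_three
    linarith
  have hJ := jensen_one_sub_cos _ hne _ hθ
  rw [hmean, card_periodBox, ← sum_periodBox_wt_real (n := n)] at hJ
  unfold levelAction fineAction
  have hsw : 0 < ((stepWt (d + 2) L)⁻¹) ^ k := pow_pos (inv_pos.mpr (stepWt_pos L hL1)) k
  refine mul_le_mul_of_nonneg_left ?_ hsw.le
  push_cast at hJ ⊢
  exact hJ.trans (sum_perWin_ge_plane01 (isUnitaryCfg_scalarCfg_imag A) M)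

/-- **★★ THE BOUND IS ATTAINED by any admissible competitor with the Landau field's plaquette variables** (`e^{±if}·1` on the `(e₀,e₁)`-plane, `1` elsewhere, `f = ω∕L^{2k}`):
its level action is exactly `(stepWt⁻¹)^k · (N L^k)^{d+2} · (1 − cos f)`. [cite: Balaban1985Variational, (5) p.278] -/
theorem levelAction_of_landau_plaquettes (L N k : ℕ) (f : ℝ) {U : B7Prop1Explicit.Site (d + 2) → Fin (d + 2) → (Matrix n n ℂ)ˣ}
    (hplaq : ∀ (x : B7Prop1Explicit.Site (d + 2)) (κ μ : Fin (d + 2)), hol U x (plaqWord κ μ)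
      = expUnit ((((if κ = 0 ∧ μ = 1 then f else if κ = 1 ∧ μ = 0 then -f else 0 : ℝ) : ℂ) * Complex.I) • (1 : Matrix n n ℂ))) :
    levelAction (d + 2) L N k U = ((stepWt (d + 2) L)⁻¹) ^ k * (((N * L ^ k : ℕ) : ℝ) ^ (d + 2) * (1 - Real.cos f)) := by
  unfold levelAction fineAction
  congr 1
  rw [perWin, Finset.sum_product]
  have hx : ∀ x : B7Prop1Explicit.Site (d + 2), ∑ π : T4AveragingDeficitWall.Plane (d + 2), wt (fhol U (x, π)) = 1 - Real.cos f := by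
    intro x
    rw [← Finset.sum_erase_add _ _ (Finset.mem_univ (π₀ (d := d)))]
    have h0 : wt (fhol U (x, π₀)) = 1 - Real.cos f := by
      simp only [fhol, π₀]
      rw [hplaq]; simp only [true_and, if_true]
      exact wt_expUnit_smul_one f
    have hrest : ∑ π ∈ Finset.univ.erase (π₀ (d := d)), wt (fhol U (x, π)) = 0 := by
      refine Finset.sum_eq_zero fun π hπ => ?_
      have hne : π ≠ π₀ := (Finset.mem_erase.mp hπ).1
      have h1 : π.1.2 ≠ 1 := snd_ne_one_of_ne hne
      have h2 : π.1.2 ≠ 0 := snd_ne_zero π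
      simp only [fhol]
      rw [hplaq]
      have hc : ¬(π.1.1 = 0 ∧ π.1.2 = 1) := fun h => h1 h.2
      have hc' : ¬(π.1.1 = 1 ∧ π.1.2 = 0) := fun h => h2 h.2
      rw [if_neg hc, if_neg hc']
      have := wt_expUnit_smul_one (n := n) 0
      simp only [Real.cos_zero, sub_self] at this
      convert this using 3
    rw [hrest, h0, zero_add]
  rw [Finset.sum_congr rfl fun x _ => hx x, Finset.sum_const, card_periodBox, nsmul_eq_mul]
  push_cast; ring

/-- **★★★ THE MINIMAL ACTION ON `𝒟_unif` (rank one)**: under the hypotheses of `levelAction_ge_of_admissible` with `|ω| ≤ ec`, the minimal level-`k` action over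
`sfClass (d+2) L N ec` at the datum is `(stepWt⁻¹)^k · (N L^k)^{d+2} · (1 − cos(ω∕L^{2k}))` — attained by file 3's uniform preimage. [cite: Balaban1985Variational, (5)–(8) pp.278–279] -/
theorem minAct_uniformScalar (hL : 2 ≤ L) (hN : 1 ≤ N) (he0 : 0 ≤ ec) (he1 : 16 * C0 (d + 2) * ec ≤ 3)
    (he2 : 1024 * ((d + 2 : ℕ) + 1 : ℝ) * ((d + 2 : ℕ) + 4) * (L : ℝ) ^ 2 * ec ≤ 1) (hωe : |ω| ≤ ec) (hω : |ω| ≤ 1 / 2)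
    (hP : IsPeriodicCfg (scalarCfg (n := n) (fun y ν => ((G y ν : ℝ) : ℂ) * Complex.I)) (N : ℤ))
    (hcurv : ∀ (x : B7Prop1Explicit.Site (d + 2)) (κ μ : Fin (d + 2)), κ ≠ μ →
      hol (scalarCfg (n := n) (fun y ν => ((G y ν : ℝ) : ℂ) * Complex.I)) x (plaqWord κ μ)
        = expUnit ((((if κ = 0 ∧ μ = 1 then ω else if κ = 1 ∧ μ = 0 then -ω else 0 : ℝ) : ℂ) * Complex.I) • (1 : Matrix n n ℂ)))
    {U : B7Prop1Explicit.Site (d + 2) → Fin (d + 2) → (Matrix n n ℂ)ˣ}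
    (hmin : IsMinimiser (d + 2) (sfClass (d + 2) L N ec) L N k (scalarCfg (n := n) (fun y ν => ((G y ν : ℝ) : ℂ) * Complex.I)) U) :
    levelAction (d + 2) L N k U = ((stepWt (d + 2) L)⁻¹) ^ k * (((N * L ^ k : ℕ) : ℝ) ^ (d + 2) * (1 - Real.cos (ω / (L : ℝ) ^ (2 * k)))) := by
  have hV01 : ∀ x : B7Prop1Explicit.Site (d + 2), hol (scalarCfg (n := n) (fun y ν => ((G y ν : ℝ) : ℂ) * Complex.I)) x (plaqWord 0 1)
      = expUnit ((((ω : ℝ) : ℂ) * Complex.I) • (1 : Matrix n n ℂ)) := fun x => by rw [hcurv x 0 1 fin_zero_ne_one]; simp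
  refine le_antisymm ?_ (levelAction_ge_of_admissible (n := n) hL hN he0 he1 he2 hω hV01 hmin.mem)
  obtain ⟨U₀, hU₀, hU₀P, hU₀S, hU₀avg, hU₀plaq⟩ := exists_periodic_uniform_preimage (n := n) hL hN hω hP hcurv k
  have hadm : U₀ ∈ admissible (sfClass (d + 2) L N ec) L k (scalarCfg (n := n) (fun y ν => ((G y ν : ℝ) : ℂ) * Complex.I)) :=
    ⟨⟨hU₀, hU₀P, MinimalActionRate.SmallField.mono hU₀S (div_le_div_of_nonneg_right hωe (by positivity))⟩, hU₀avg⟩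
  rw [← levelAction_of_landau_plaquettes (n := n) L N k (ω / (L : ℝ) ^ (2 * k)) hU₀plaq]
  exact hmin.le U₀ hadm

/-- **★★★ EVERY MINIMISER HAS THE LANDAU FIELD's PLAQUETTE VARIABLES** (rank one, `𝒟_unif`): `e^{±iω∕L^{2k}}·1` on the `(e₀,e₁)`-plane and `1` on every other plaquette — Jensen's
equality case plane by plane, propagated off the period box by periodicity. [cite: Balaban1985Variational, Thm 1 (8)–(10) p.279] -/
theorem plaquettes_of_isMinimiser (hL : 2 ≤ L) (hN : 1 ≤ N) (he0 : 0 ≤ ec) (he1 : 16 * C0 (d + 2) * ec ≤ 3)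
    (he2 : 1024 * ((d + 2 : ℕ) + 1 : ℝ) * ((d + 2 : ℕ) + 4) * (L : ℝ) ^ 2 * ec ≤ 1) (hωe : |ω| ≤ ec) (hω : |ω| ≤ 1 / 2)
    (hP : IsPeriodicCfg (scalarCfg (n := n) (fun y ν => ((G y ν : ℝ) : ℂ) * Complex.I)) (N : ℤ))
    (hcurv : ∀ (x : B7Prop1Explicit.Site (d + 2)) (κ μ : Fin (d + 2)), κ ≠ μ →
      hol (scalarCfg (n := n) (fun y ν => ((G y ν : ℝ) : ℂ) * Complex.I)) x (plaqWord κ μ)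
        = expUnit ((((if κ = 0 ∧ μ = 1 then ω else if κ = 1 ∧ μ = 0 then -ω else 0 : ℝ) : ℂ) * Complex.I) • (1 : Matrix n n ℂ)))
    {U : B7Prop1Explicit.Site (d + 2) → Fin (d + 2) → (Matrix n n ℂ)ˣ}
    (hmin : IsMinimiser (d + 2) (sfClass (d + 2) L N ec) L N k (scalarCfg (n := n) (fun y ν => ((G y ν : ℝ) : ℂ) * Complex.I)) U) :
    ∀ (x : B7Prop1Explicit.Site (d + 2)) (κ μ : Fin (d + 2)), κ ≠ μ → hol U x (plaqWord κ μ)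
      = expUnit ((((if κ = 0 ∧ μ = 1 then ω / (L : ℝ) ^ (2 * k) else if κ = 1 ∧ μ = 0 then -(ω / (L : ℝ) ^ (2 * k)) else 0 : ℝ) : ℂ) * Complex.I) •
        (1 : Matrix n n ℂ)) := by
  have hL1 : 1 ≤ L := by omega
  set f : ℝ := ω / (L : ℝ) ^ (2 * k) with hf
  have hV01 : ∀ x : B7Prop1Explicit.Site (d + 2), hol (scalarCfg (n := n) (fun y ν => ((G y ν : ℝ) : ℂ) * Complex.I)) x (plaqWord 0 1)
      = expUnit ((((ω : ℝ) : ℂ) * Complex.I) • (1 : Matrix n n ℂ)) := fun x => by rw [hcurv x 0 1 fin_zero_ne_one]; simp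
  have hval := minAct_uniformScalar (n := n) hL hN he0 he1 he2 hωe hω hP hcurv hmin
  obtain ⟨A, hA⟩ := exists_real_presentation (n := n) hmin.mem.1.1
  have hadm := hmin.mem
  rw [hA] at hadm hval
  obtain ⟨_, hbox⟩ := sliceFlux_of_admissible (n := n) hL hN he0 he1 he2 hω hV01 hadm
  set M : ℕ := N * L ^ k with hMdef
  have hM : 1 ≤ M := Nat.one_le_iff_ne_zero.mpr (Nat.mul_ne_zero (by omega) (pow_ne_zero _ (by omega)))
  have hne : (periodBox (d := d + 2) M).Nonempty := by rw [← Finset.card_pos, card_periodBox]; positivity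
  have hmean : (∑ x ∈ periodBox M, toIocMod Real.two_pi_pos (-Real.pi) (asum A x (plaqWord 0 1))) / (periodBox (d := d + 2) M).card = f := by
    rw [hf]
    have hMne : ((M : ℕ) : ℝ) ≠ 0 := by positivity
    have hN0 : (N : ℝ) ≠ 0 := by exact_mod_cast (show N ≠ 0 by omega)
    have hL0 : (L : ℝ) ≠ 0 := by exact_mod_cast (show L ≠ 0 by omega)
    have hsum : ∑ x ∈ periodBox M, toIocMod Real.two_pi_pos (-Real.pi) (asum A x (plaqWord 0 1)) = ((M : ℕ) : ℝ) ^ d * ((N : ℝ) ^ 2 * ω) := by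
      apply mul_left_cancel₀ (pow_ne_zero 2 hMne)
      rw [hbox]; ring
    rw [card_periodBox, hsum, Nat.cast_pow, hMdef, Nat.cast_mul, Nat.cast_pow, pow_mul]
    field_simp
    ring
  have hθ : ∀ x ∈ periodBox M, |toIocMod Real.two_pi_pos (-Real.pi) (asum A x (plaqWord 0 1))| ≤ Real.pi / 2 := by
    intro x _
    refine (abs_toIocMod_le_two_mul (n := n) hadm.1.2.2 x fin_zero_ne_one).trans ?_
    have hL1r : (1 : ℝ) ≤ ((L : ℝ) ^ k) ^ 2 := one_le_pow₀ (one_le_pow₀ (by exact_mod_cast hL1))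
    have h1 : ec / ((L : ℝ) ^ k) ^ 2 ≤ ec := div_le_self he0 hL1r
    have h2 : ec ≤ 1 / 1024 := by
      have hd0 : (0 : ℝ) ≤ d := by positivity
      have hL2r : (2 : ℝ) ≤ L := by exact_mod_cast hL
      have h4 : (4 : ℝ) ≤ ((d + 2 : ℕ) + 1 : ℝ) * ((d + 2 : ℕ) + 4) := by push_cast; nlinarith
      have hL2 : (1 : ℝ) ≤ (L : ℝ) ^ 2 := by nlinarith
      have h44 : (4 : ℝ) ≤ ((d + 2 : ℕ) + 1 : ℝ) * ((d + 2 : ℕ) + 4) * (L : ℝ) ^ 2 := by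
        have := mul_le_mul h4 hL2 zero_le_one (by positivity); linarith
      nlinarith
    have hπ : (3 : ℝ) < Real.pi := Real.pi_gt_three
    linarith
  -- the two inequalities `≥ plane part ≥ Jensen` are equalities
  have hsw : 0 < ((stepWt (d + 2) L)⁻¹) ^ k := pow_pos (inv_pos.mpr (stepWt_pos L hL1)) k
  have hJ := jensen_one_sub_cos _ hne _ hθ
  have hP1 := sum_perWin_ge_plane01 (n := n) (isUnitaryCfg_scalarCfg_imag A) M
  rw [hmean, card_periodBox, ← sum_periodBox_wt_real (n := n)] at hJ
  unfold levelAction fineAction at hval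
  rw [← hMdef] at hval
  have hval' : ∑ p ∈ perWin (d + 2) M, wt (fhol (scalarCfg (n := n) (fun y ν => ((A y ν : ℝ) : ℂ) * Complex.I)) p)
      = ((M : ℕ) : ℝ) ^ (d + 2) * (1 - Real.cos f) := by
    have := mul_left_cancel₀ hsw.ne' hval
    rw [this]
  push_cast at hJ hval' hP1
  have heq1 : ∑ p ∈ perWin (d + 2) M, wt (fhol (scalarCfg (n := n) (fun y ν => ((A y ν : ℝ) : ℂ) * Complex.I)) p)
      = ∑ x ∈ periodBox M, wt (hol (scalarCfg (n := n) (fun y ν => ((A y ν : ℝ) : ℂ) * Complex.I)) x (plaqWord 0 1)) := by linarith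
  have heq2 : ∑ x ∈ periodBox M, (1 - Real.cos (toIocMod Real.two_pi_pos (-Real.pi) (asum A x (plaqWord 0 1))))
      = ((periodBox (d := d + 2) M).card : ℝ) * (1 - Real.cos ((∑ x ∈ periodBox M, toIocMod Real.two_pi_pos (-Real.pi) (asum A x (plaqWord 0 1))) /
          (periodBox (d := d + 2) M).card)) := by
    rw [hmean, card_periodBox, ← sum_periodBox_wt_real (n := n)]; push_cast; linarith
  have hall := jensen_one_sub_cos_eq_iff _ hne _ hθ heq2
  rw [hmean] at hall
  -- periodicity moves any site into the period box
  have hθper : ∀ (y : B7Prop1Explicit.Site (d + 2)) (ι α β : Fin (d + 2)),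
      toIocMod Real.two_pi_pos (-Real.pi) (asum A (y + (M : ℤ) • e ι) (plaqWord α β)) = toIocMod Real.two_pi_pos (-Real.pi) (asum A y (plaqWord α β)) :=
    fun y ι α β => toIocMod_periodic (n := n) hadm.1.2.1 y ι α β
  have hwrap : ∀ y : B7Prop1Explicit.Site (d + 2), ∃ x ∈ periodBox (d := d + 2) M, ∀ α β : Fin (d + 2),
      hol (scalarCfg (n := n) (fun y ν => ((A y ν : ℝ) : ℂ) * Complex.I)) y (plaqWord α β)
        = hol (scalarCfg (n := n) (fun y ν => ((A y ν : ℝ) : ℂ) * Complex.I)) x (plaqWord α β) := fun y =>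
    ⟨fun ι => y ι % (M : ℤ), wrap_mem_periodBox M hM y, fun α β =>
      (apply_wrap_eq (g := fun z => hol (scalarCfg (n := n) (fun y ν => ((A y ν : ℝ) : ℂ) * Complex.I)) z (plaqWord α β)) (P := M)
        (fun z ι => hol_add_period hadm.1.2.1 ι _ z) y).symm⟩
  have hθwrap : ∀ (y x : B7Prop1Explicit.Site (d + 2)) (α β : Fin (d + 2)),
      hol (scalarCfg (n := n) (fun y ν => ((A y ν : ℝ) : ℂ) * Complex.I)) y (plaqWord α β)
        = hol (scalarCfg (n := n) (fun y ν => ((A y ν : ℝ) : ℂ) * Complex.I)) x (plaqWord α β) →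
      toIocMod Real.two_pi_pos (-Real.pi) (asum A y (plaqWord α β)) = toIocMod Real.two_pi_pos (-Real.pi) (asum A x (plaqWord α β)) := by
    intro y x α β h
    apply toIocMod_eq_of_cexp_smul_one_eq (n := n)
    have h1 := val_hol_plaqWord_real (n := n) A y α β
    have h2 := val_hol_plaqWord_real (n := n) A x α β
    rw [cexp_toIocMod_mul_I] at h1 h2
    rw [← h1, ← h2, h]
  -- conclusion, plane by plane
  intro x κ μ hκμ
  rw [hA]
  obtain ⟨x₀, hx₀, hxw⟩ := hwrap x
  apply Units.ext
  rw [val_hol_plaqWord_real, val_expUnit, ← cexp_smul_one, hθwrap x x₀ κ μ (hxw κ μ)]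
  have hπ : (3 : ℝ) < Real.pi := Real.pi_gt_three
  -- the principal angle at `x₀ ∈ periodBox`, for every ordered pair of directions
  have hθx : toIocMod Real.two_pi_pos (-Real.pi) (asum A x₀ (plaqWord κ μ))
      = (if κ = 0 ∧ μ = 1 then f else if κ = 1 ∧ μ = 0 then -f else 0 : ℝ) := by
    -- every plane other than `(e₀,e₁)` weighs zero at `x₀`, so its principal angle vanishes
    have hoff : ∀ (α β : Fin (d + 2)) (hαβ : α < β), ¬(α = 0 ∧ β = 1) → toIocMod Real.two_pi_pos (-Real.pi) (asum A x₀ (plaqWord α β)) = 0 := by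
      intro α β hαβ hne01
      have hπne : (⟨(α, β), hαβ⟩ : T4AveragingDeficitWall.Plane (d + 2)) ≠ π₀ := by
        intro h
        have h' := congrArg (fun π : T4AveragingDeficitWall.Plane (d + 2) => π.1) h
        simp only [π₀] at h'
        exact hne01 ⟨(Prod.mk.inj h').1, (Prod.mk.inj h').2⟩
      have hw := wt_eq_zero_of_sum_perWin_eq (n := n) (isUnitaryCfg_scalarCfg_imag A) M heq1 hx₀ hπne
      simp only [fhol] at hw
      rw [wt_hol_plaqWord_real] at hw
      have hb := abs_le.mp (abs_toIocMod_le_pi (asum A x₀ (plaqWord α β)))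
      exact (Real.cos_eq_one_iff_of_lt_of_lt (by linarith) (by linarith)).mp (by linarith)
    -- antisymmetry of the real curl, transported to principal angles away from the boundary
    have hanti : ∀ (α β : Fin (d + 2)), |toIocMod Real.two_pi_pos (-Real.pi) (asum A x₀ (plaqWord α β))| < Real.pi →
        toIocMod Real.two_pi_pos (-Real.pi) (asum A x₀ (plaqWord β α)) = -toIocMod Real.two_pi_pos (-Real.pi) (asum A x₀ (plaqWord α β)) := by
      intro α β hlt
      set t := toIocMod Real.two_pi_pos (-Real.pi) (asum A x₀ (plaqWord α β)) with ht
      have hneg : asum A x₀ (plaqWord β α) = -asum A x₀ (plaqWord α β) := by rw [asum_plaqWord, asum_plaqWord]; ring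
      obtain ⟨m, hm⟩ : ∃ m : ℤ, asum A x₀ (plaqWord α β) = t + m • (2 * Real.pi) :=
        ⟨toIocDiv Real.two_pi_pos (-Real.pi) _, by rw [ht]; exact (toIocMod_add_toIocDiv_zsmul _ _ _).symm⟩
      rw [hneg, hm, neg_add, ← neg_zsmul, toIocMod_add_zsmul, toIocMod_eq_self, Set.mem_Ioc]
      rw [abs_lt] at hlt
      constructor <;> linarith [hlt.1, hlt.2]
    by_cases h01 : κ = 0 ∧ μ = 1
    · obtain ⟨rfl, rfl⟩ := h01
      rw [if_pos ⟨rfl, rfl⟩, hall x₀ hx₀]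
    rw [if_neg h01]
    by_cases h10 : κ = 1 ∧ μ = 0
    · obtain ⟨rfl, rfl⟩ := h10
      rw [if_pos ⟨rfl, rfl⟩, hanti 0 1 (by rw [hall x₀ hx₀]; have := hθ x₀ hx₀; rw [hall x₀ hx₀] at this; exact lt_of_le_of_lt this (by linarith)),
        hall x₀ hx₀]
    rw [if_neg h10]
    rcases lt_or_gt_of_ne hκμ with hlt | hgt
    · exact hoff κ μ hlt h01
    · rw [hanti μ κ (by rw [hoff μ κ hgt (fun h => h10 ⟨h.2, h.1⟩), abs_zero]; positivity), hoff μ κ hgt (fun h => h10 ⟨h.2, h.1⟩), neg_zero]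
  rw [hθx]

/-- **★★★ EVERY MINIMISER IS A CENTRAL GAUGE TRANSFORM OF THE LANDAU FIELD** `U_{ω∕L^{2k}, 0, 0}` (rank one, `𝒟_unif`; file 2's «same plaquettes ⟹ central gauge»).
[cite: Balaban1985Variational, Thm 1 p.279] -/
theorem exists_central_gauge_of_isMinimiser (hL : 2 ≤ L) (hN : 1 ≤ N) (he0 : 0 ≤ ec) (he1 : 16 * C0 (d + 2) * ec ≤ 3)
    (he2 : 1024 * ((d + 2 : ℕ) + 1 : ℝ) * ((d + 2 : ℕ) + 4) * (L : ℝ) ^ 2 * ec ≤ 1) (hωe : |ω| ≤ ec) (hω : |ω| ≤ 1 / 2)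
    (hP : IsPeriodicCfg (scalarCfg (n := n) (fun y ν => ((G y ν : ℝ) : ℂ) * Complex.I)) (N : ℤ))
    (hcurv : ∀ (x : B7Prop1Explicit.Site (d + 2)) (κ μ : Fin (d + 2)), κ ≠ μ →
      hol (scalarCfg (n := n) (fun y ν => ((G y ν : ℝ) : ℂ) * Complex.I)) x (plaqWord κ μ)
        = expUnit ((((if κ = 0 ∧ μ = 1 then ω else if κ = 1 ∧ μ = 0 then -ω else 0 : ℝ) : ℂ) * Complex.I) • (1 : Matrix n n ℂ)))
    {U : B7Prop1Explicit.Site (d + 2) → Fin (d + 2) → (Matrix n n ℂ)ˣ}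
    (hmin : IsMinimiser (d + 2) (sfClass (d + 2) L N ec) L N k (scalarCfg (n := n) (fun y ν => ((G y ν : ℝ) : ℂ) * Complex.I)) U) :
    ∃ u : B7Prop1Explicit.Site (d + 2) → (Matrix n n ℂ)ˣ, (∀ x, u x ∈ unitaryUnits (Matrix n n ℂ)) ∧
      (∀ (x : B7Prop1Explicit.Site (d + 2)) (X : Matrix n n ℂ), (u x : Matrix n n ℂ) * X = X * u x) ∧
      U = gaugeAct u (scalarCfg (n := n) (fun (x : B7Prop1Explicit.Site (d + 2)) (κ : Fin (d + 2)) =>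
        ((if κ = 1 then (ω / (L : ℝ) ^ (2 * k)) * ((x 0 : ℤ) : ℝ) + 0 else if κ = 0 then (0 : ℝ) else 0 : ℝ) : ℂ) * Complex.I)) := by
  obtain ⟨A, hA⟩ := exists_real_presentation (n := n) hmin.mem.1.1
  have hplaq := plaquettes_of_isMinimiser (n := n) hL hN he0 he1 he2 hωe hω hP hcurv hmin
  rw [hA] at hplaq ⊢
  exact exists_central_gauge_of_hol_plaqWord_eq (n := n) (isUnitaryCfg_scalarCfg_imag A) (isUnitaryCfg_landau (f := ω / (L : ℝ) ^ (2 * k)) (a := 0) (c := 0)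
    (fun _ _ => rfl)) (fun x κ μ hκμ => by rw [hplaq x κ μ hκμ, hol_plaqWord_landau (f := ω / (L : ℝ) ^ (2 * k)) (a := 0) (c := 0) (fun _ _ => rfl)])

/-- **★★ UNIQUENESS UP TO GAUGE** (rank one, `𝒟_unif`): two minimisers at the same datum differ by a central unitary gauge. [cite: Balaban1985Variational, Thm 1 p.279] -/
theorem isMinimiser_unique_up_to_gauge (hL : 2 ≤ L) (hN : 1 ≤ N) (he0 : 0 ≤ ec) (he1 : 16 * C0 (d + 2) * ec ≤ 3)
    (he2 : 1024 * ((d + 2 : ℕ) + 1 : ℝ) * ((d + 2 : ℕ) + 4) * (L : ℝ) ^ 2 * ec ≤ 1) (hωe : |ω| ≤ ec) (hω : |ω| ≤ 1 / 2)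
    (hP : IsPeriodicCfg (scalarCfg (n := n) (fun y ν => ((G y ν : ℝ) : ℂ) * Complex.I)) (N : ℤ))
    (hcurv : ∀ (x : B7Prop1Explicit.Site (d + 2)) (κ μ : Fin (d + 2)), κ ≠ μ →
      hol (scalarCfg (n := n) (fun y ν => ((G y ν : ℝ) : ℂ) * Complex.I)) x (plaqWord κ μ)
        = expUnit ((((if κ = 0 ∧ μ = 1 then ω else if κ = 1 ∧ μ = 0 then -ω else 0 : ℝ) : ℂ) * Complex.I) • (1 : Matrix n n ℂ)))
    {U U' : B7Prop1Explicit.Site (d + 2) → Fin (d + 2) → (Matrix n n ℂ)ˣ}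
    (hmin : IsMinimiser (d + 2) (sfClass (d + 2) L N ec) L N k (scalarCfg (n := n) (fun y ν => ((G y ν : ℝ) : ℂ) * Complex.I)) U)
    (hmin' : IsMinimiser (d + 2) (sfClass (d + 2) L N ec) L N k (scalarCfg (n := n) (fun y ν => ((G y ν : ℝ) : ℂ) * Complex.I)) U') :
    ∃ u : B7Prop1Explicit.Site (d + 2) → (Matrix n n ℂ)ˣ, (∀ x, u x ∈ unitaryUnits (Matrix n n ℂ)) ∧
      (∀ (x : B7Prop1Explicit.Site (d + 2)) (X : Matrix n n ℂ), (u x : Matrix n n ℂ) * X = X * u x) ∧ U' = gaugeAct u U := by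
  obtain ⟨A, hA⟩ := exists_real_presentation (n := n) hmin.mem.1.1
  obtain ⟨A', hA'⟩ := exists_real_presentation (n := n) hmin'.mem.1.1
  have h1 := plaquettes_of_isMinimiser (n := n) hL hN he0 he1 he2 hωe hω hP hcurv hmin
  have h2 := plaquettes_of_isMinimiser (n := n) hL hN he0 he1 he2 hωe hω hP hcurv hmin'
  rw [hA] at h1 ⊢; rw [hA'] at h2 ⊢
  exact exists_central_gauge_of_hol_plaqWord_eq (n := n) (isUnitaryCfg_scalarCfg_imag A') (isUnitaryCfg_scalarCfg_imag A)
    (fun x κ μ hκμ => by rw [h2 x κ μ hκμ, h1 x κ μ hκμ])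

end Minimisers

end

end Summit.QuantumFields.YangMills.BalabanUVNodes.N16UniformScalarMinimisers
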